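import Literature.Analysis.FluidPDE.QuasiSelfSimilarGenerators
import HarnessLib

/-!
# Cell identities in coordinates: the self-similarity hypothesis of the generator reduction

Topic `Literature/Analysis/FluidPDE`. Consumer-end bookkeeping for a discharge of
`acm_compatible_blocks` (`QuasiSelfSimilarCompatibleBlocks.lean`) through
`acm_compatible_blocks_of_generators` / `acm_compatible_blocks_of_generator_moves[_peano]`
(`QuasiSelfSimilarGenerators.lean`, `QuasiSelfSimilarGeneratorMoves.lean`). Their generator-level
self-similarity hypothesis reads, for every generator `g`, subsquare `p` and `z` in the open
subsquare,

  `Θ₀ g 1 z = (childSym g p).toSymm.actScalar (Θ₀ (childGen g p)) 0 (5 • z - latticeVec p)`,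

an identity between the designed field at `t = 1` and a symmetry image of a generator's initial
datum, phrased through `SquareSymm.actScalar`, `SymmCode.toSymm`, `latticeVec`. This file unpacks
it into plain coordinates, which is the form in which an explicit design checks it:

* `SymmCode.toSymm_inv_act_apply`, `SymmCode.codePoint` / `SymmCode.inv_act_eq_codePoint`: the
  point `c.toSymm⁻¹ • w` has coordinates obtained from `(w₀, w₁)` by the flips `x ↦ 1 - x`
  (`flipCoord`) and the swap recorded in the code `c`; `smul_sub_latticeVec_apply`:
  `(5 • z - latticeVec p)_k = 5 z_k - p_k`, which lies in `(0,1)` on the open subsquare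
  (`mem_Ioo_of_mem_latticeCellInterior`);
* **straight children**: if the straight generator's initial datum is a transversal profile,
  `Θ₀ S 0 u = G(u₁ - 1/2)` on the open unit square with `G` even (`QuasiSelfSimilarChannelProfile`),
  then its image under ANY code `c` is `G(w_{k} - 1/2)` with `k = c.perm⁻¹ 1`
  (`SymmCode.actScalar_straightTile`), i.e. on the subsquare `p` the required value is
  `G(5 z₁ - p₁ - 1/2)` (no swap) or `G(5 z₀ - p₀ - 1/2)` (swap) — a straight band of one fifth the
  width along the midline of the cell (`cellIdentity_straight`, `…_noswap`, `…_swap`);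
* **bent children**: the required value is `Θ₀ B 0 (c.codePoint (5 z₀ - p₀, 5 z₁ - p₁))`
  (`cellIdentity_code`), explicit once `c` is a literal code;
* `selfSimilar_of_cells`: the hypothesis `hS` of the generator reductions, for arbitrary tables
  `(childGen, childSym)`, from the two families of coordinate identities.

Folklore; the file states no named fact (net debt `0`).

## References

* G. Alberti, G. Crippa, A. L. Mazzucato, *Exponential self-similar mixing by incompressible
  flows*, J. Amer. Math. Soc. 32 (2019), 445–490, §8.1 (e), §8.2 (arXiv:1605.02090).
-/

noncomputable section

open Set Function

namespace Literature.Analysis.FluidPDE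

namespace QuasiSelfSimilar

open FunctionSpaces FunctionSpaces.Torus

/-! ## Coordinates of the inverse action of a code -/

/-- **Flip of a coordinate of the unit square**: `1 - x` if the flag is set, else `x`. [folklore] -/
def flipCoord (b : Bool) (x : ℝ) : ℝ := if b then 1 - x else x

/-- Flipping. [folklore] -/
@[simp] theorem flipCoord_true (x : ℝ) : flipCoord true x = 1 - x := rfl

/-- Not flipping. [folklore] -/
@[simp] theorem flipCoord_false (x : ℝ) : flipCoord false x = x := rfl

/-- A flip preserves the open unit interval. [folklore] -/
theorem flipCoord_mem_Ioo (b : Bool) {x : ℝ} (hx : x ∈ Ioo (0 : ℝ) 1) : flipCoord b x ∈ Ioo (0 : ℝ) 1 := by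
  cases b
  · exact hx
  · exact ⟨by simp [hx.2], by simp [hx.1]⟩

/-- An even function does not see a flip about `1/2`: `G(flipCoord b x - 1/2) = G(x - 1/2)`.
[folklore] -/
theorem apply_flipCoord_sub_half {G : ℝ → ℝ} (hG : ∀ x, G (-x) = G x) (b : Bool) (x : ℝ) :
    G (flipCoord b x - 2⁻¹) = G (x - 2⁻¹) := by
  cases b
  · rfl
  · rw [flipCoord_true, ← hG]; congr 1; ring

namespace SymmCode

variable (c : SymmCode)

/-- **Coordinates of the inverse action of a code**:
`(c⁻¹ • w)_j = 1 - w_{perm⁻¹ j}` if `flip (perm⁻¹ j)`, else `w_{perm⁻¹ j}`. [folklore] -/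
theorem toSymm_inv_act_apply (w : EuclideanSpace ℝ (Fin 2)) (j : Fin 2) :
    c.toSymm.inv.act w j = flipCoord (c.flip (c.perm.symm j)) (w (c.perm.symm j)) := rfl

/-- Without swap the permutation is the identity. [folklore] -/
theorem perm_of_swap_false (hc : c.swap = false) : c.perm = Equiv.refl _ := by
  simp [SymmCode.perm, hc]

/-- With swap the permutation is the transposition. [folklore] -/
theorem perm_of_swap_true (hc : c.swap = true) : c.perm = Equiv.swap 0 1 := by
  simp [SymmCode.perm, hc]

/-- Without swap, `perm⁻¹ j = j`. [folklore] -/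
@[simp] theorem perm_symm_apply_of_swap_false (hc : c.swap = false) (j : Fin 2) : c.perm.symm j = j := by
  simp [c.perm_of_swap_false hc]

/-- With swap, `perm⁻¹ 0 = 1`. [folklore] -/
@[simp] theorem perm_symm_zero_of_swap_true (hc : c.swap = true) : c.perm.symm 0 = 1 := by
  simp [c.perm_of_swap_true hc, Equiv.symm_swap]

/-- With swap, `perm⁻¹ 1 = 0`. [folklore] -/
@[simp] theorem perm_symm_one_of_swap_true (hc : c.swap = true) : c.perm.symm 1 = 0 := by
  simp [c.perm_of_swap_true hc, Equiv.symm_swap]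

/-- **The inverse action of a code in coordinates**: from `(w₀, w₁)`, flip each coordinate
according to its flag, then swap the two if the code swaps. [folklore] -/
def codePoint (w : EuclideanSpace ℝ (Fin 2)) : EuclideanSpace ℝ (Fin 2) :=
  if c.swap then WithLp.toLp 2 ![flipCoord (c.flip 1) (w 1), flipCoord (c.flip 0) (w 0)]
  else WithLp.toLp 2 ![flipCoord (c.flip 0) (w 0), flipCoord (c.flip 1) (w 1)]

/-- Coordinates of `codePoint` without swap. [folklore] -/
theorem codePoint_apply_of_swap_false (hc : c.swap = false) (w : EuclideanSpace ℝ (Fin 2)) (j : Fin 2) :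
    c.codePoint w j = flipCoord (c.flip j) (w j) := by
  unfold codePoint; rw [if_neg (by simp [hc])]
  fin_cases j <;> rfl

/-- First coordinate of `codePoint` with swap. [folklore] -/
theorem codePoint_apply_zero_of_swap_true (hc : c.swap = true) (w : EuclideanSpace ℝ (Fin 2)) :
    c.codePoint w 0 = flipCoord (c.flip 1) (w 1) := by
  unfold codePoint; rw [if_pos hc]; rfl

/-- Second coordinate of `codePoint` with swap. [folklore] -/
theorem codePoint_apply_one_of_swap_true (hc : c.swap = true) (w : EuclideanSpace ℝ (Fin 2)) :
    c.codePoint w 1 = flipCoord (c.flip 0) (w 0) := by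
  unfold codePoint; rw [if_pos hc]; rfl

/-- **`c.toSymm⁻¹ • w = c.codePoint w`.** [folklore] -/
theorem inv_act_eq_codePoint (w : EuclideanSpace ℝ (Fin 2)) : c.toSymm.inv.act w = c.codePoint w := by
  ext j
  rw [toSymm_inv_act_apply]
  cases hc : c.swap
  · rw [c.codePoint_apply_of_swap_false hc, c.perm_symm_apply_of_swap_false hc]
  · fin_cases j
    · simp only [Fin.zero_eta]
      rw [c.codePoint_apply_zero_of_swap_true hc, c.perm_symm_zero_of_swap_true hc]
    · simp only [Fin.mk_one]
      rw [c.codePoint_apply_one_of_swap_true hc, c.perm_symm_one_of_swap_true hc]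

/-- The action of a code on a scalar, in coordinates: `(c • Θ)(t, w) = Θ(t, c.codePoint w)`.
[folklore] -/
theorem actScalar_eq_codePoint (Θ : ℝ → EuclideanSpace ℝ (Fin 2) → ℝ) (t : ℝ) (w : EuclideanSpace ℝ (Fin 2)) :
    c.toSymm.actScalar Θ t w = Θ t (c.codePoint w) := by
  rw [SquareSymm.actScalar_apply, inv_act_eq_codePoint]

/-- The inverse action of a code preserves the open unit square. [folklore] -/
theorem inv_act_mem_openSquare {w : EuclideanSpace ℝ (Fin 2)} (hw : ∀ k, w k ∈ Ioo (0 : ℝ) 1) (j : Fin 2) :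
    c.toSymm.inv.act w j ∈ Ioo (0 : ℝ) 1 := by
  rw [toSymm_inv_act_apply]
  exact flipCoord_mem_Ioo _ (hw _)

/-- **A straight tile under a code.** If on the open unit square `Θ(0, u) = G(u₁ - 1/2)` with `G`
even, then for every code `c` and `w` in the open unit square,
`(c • Θ)(0, w) = G(w_k - 1/2)` with `k = perm⁻¹ 1` (the flips are invisible by evenness).
[folklore] -/
theorem actScalar_straightTile {Θ : ℝ → EuclideanSpace ℝ (Fin 2) → ℝ} {G : ℝ → ℝ} (hG : ∀ x, G (-x) = G x)
    (hΘ : ∀ u : EuclideanSpace ℝ (Fin 2), (∀ k, u k ∈ Ioo (0 : ℝ) 1) → Θ 0 u = G (u 1 - 2⁻¹)) {w : EuclideanSpace ℝ (Fin 2)}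
    (hw : ∀ k, w k ∈ Ioo (0 : ℝ) 1) :
    c.toSymm.actScalar Θ 0 w = G (w (c.perm.symm 1) - 2⁻¹) := by
  rw [SquareSymm.actScalar_apply, hΘ _ (c.inv_act_mem_openSquare hw), toSymm_inv_act_apply,
    apply_flipCoord_sub_half hG]

end SymmCode

/-! ## The rescaled point of a subsquare -/

/-- **Coordinates of the rescaled point**: `(5 • z - latticeVec p)_k = 5 z_k - p_k`. [folklore] -/
theorem smul_sub_latticeVec_apply (p : Fin 2 → Fin 5) (z : EuclideanSpace ℝ (Fin 2)) (k : Fin 2) :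
    ((5 : ℝ) • z - latticeVec (fun k => ((p k : ℕ) : ℤ))) k = 5 * z k - (p k : ℕ) := by
  rw [PiLp.sub_apply, PiLp.smul_apply, latticeVec_apply, smul_eq_mul, Int.cast_natCast]

/-- On the open subsquare `p`, `5 z_k - p_k ∈ (0, 1)`. [folklore] -/
theorem mem_Ioo_of_mem_latticeCellInterior {p : Fin 2 → Fin 5} {z : EuclideanSpace ℝ (Fin 2)}
    (hz : z ∈ latticeCellInterior 5 (fun k => ((p k : ℕ) : ℤ))) (k : Fin 2) :
    5 * z k - (p k : ℕ) ∈ Ioo (0 : ℝ) 1 := by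
  obtain ⟨ha, hb⟩ := hz k
  simp only [Int.cast_natCast, Nat.cast_ofNat] at ha hb
  rw [div_lt_iff₀ (by norm_num : (0 : ℝ) < 5)] at ha
  rw [lt_div_iff₀ (by norm_num : (0 : ℝ) < 5)] at hb
  constructor <;> linarith

/-- The rescaled point of the open subsquare lies in the open unit square. [folklore] -/
theorem smul_sub_latticeVec_mem_openSquare {p : Fin 2 → Fin 5} {z : EuclideanSpace ℝ (Fin 2)}
    (hz : z ∈ latticeCellInterior 5 (fun k => ((p k : ℕ) : ℤ))) (k : Fin 2) :
    ((5 : ℝ) • z - latticeVec (fun k => ((p k : ℕ) : ℤ))) k ∈ Ioo (0 : ℝ) 1 := by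
  rw [smul_sub_latticeVec_apply]
  exact mem_Ioo_of_mem_latticeCellInterior hz k

/-- The rescaled point written out: `5 • z - latticeVec p = (5 z₀ - p₀, 5 z₁ - p₁)`. [folklore] -/
theorem smul_sub_latticeVec_eq (p : Fin 2 → Fin 5) (z : EuclideanSpace ℝ (Fin 2)) :
    (5 : ℝ) • z - latticeVec (fun k => ((p k : ℕ) : ℤ)) =
      WithLp.toLp 2 ![5 * z 0 - (p 0 : ℕ), 5 * z 1 - (p 1 : ℕ)] := by
  ext k
  rw [smul_sub_latticeVec_apply]
  fin_cases k <;> rfl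

/-! ## Cell identities -/

section Cells

variable {Θ : ℝ → EuclideanSpace ℝ (Fin 2) → ℝ} {G : ℝ → ℝ} (c : SymmCode) {p : Fin 2 → Fin 5} {z : EuclideanSpace ℝ (Fin 2)}

/-- **Straight child, general code**: the value required on the open subsquare `p` from a child
`c • Θ_S` is `G(5 z_k - p_k - 1/2)`, `k = perm⁻¹ 1`. [folklore] -/
theorem cellIdentity_straight (hG : ∀ x, G (-x) = G x)
    (hΘ : ∀ u : EuclideanSpace ℝ (Fin 2), (∀ k, u k ∈ Ioo (0 : ℝ) 1) → Θ 0 u = G (u 1 - 2⁻¹))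
    (hz : z ∈ latticeCellInterior 5 (fun k => ((p k : ℕ) : ℤ))) :
    c.toSymm.actScalar Θ 0 ((5 : ℝ) • z - latticeVec (fun k => ((p k : ℕ) : ℤ))) =
      G (5 * z (c.perm.symm 1) - (p (c.perm.symm 1) : ℕ) - 2⁻¹) := by
  rw [c.actScalar_straightTile hG hΘ (smul_sub_latticeVec_mem_openSquare hz), smul_sub_latticeVec_apply]

/-- **Straight child, no swap** (a horizontal straight child): the required value is
`G(5 z₁ - p₁ - 1/2)`. [folklore] -/
theorem cellIdentity_straight_noswap (hc : c.swap = false) (hG : ∀ x, G (-x) = G x)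
    (hΘ : ∀ u : EuclideanSpace ℝ (Fin 2), (∀ k, u k ∈ Ioo (0 : ℝ) 1) → Θ 0 u = G (u 1 - 2⁻¹))
    (hz : z ∈ latticeCellInterior 5 (fun k => ((p k : ℕ) : ℤ))) :
    c.toSymm.actScalar Θ 0 ((5 : ℝ) • z - latticeVec (fun k => ((p k : ℕ) : ℤ))) =
      G (5 * z 1 - (p 1 : ℕ) - 2⁻¹) := by
  rw [cellIdentity_straight c hG hΘ hz, c.perm_symm_apply_of_swap_false hc]

/-- **Straight child, swap** (a vertical straight child): the required value is
`G(5 z₀ - p₀ - 1/2)`. [folklore] -/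
theorem cellIdentity_straight_swap (hc : c.swap = true) (hG : ∀ x, G (-x) = G x)
    (hΘ : ∀ u : EuclideanSpace ℝ (Fin 2), (∀ k, u k ∈ Ioo (0 : ℝ) 1) → Θ 0 u = G (u 1 - 2⁻¹))
    (hz : z ∈ latticeCellInterior 5 (fun k => ((p k : ℕ) : ℤ))) :
    c.toSymm.actScalar Θ 0 ((5 : ℝ) • z - latticeVec (fun k => ((p k : ℕ) : ℤ))) =
      G (5 * z 0 - (p 0 : ℕ) - 2⁻¹) := by
  rw [cellIdentity_straight c hG hΘ hz, c.perm_symm_one_of_swap_true hc]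

/-- **Any child, in coordinates**: the value required on the subsquare `p` from a child `c • Θ`
is `Θ(0, c.codePoint (5 z₀ - p₀, 5 z₁ - p₁))`. [folklore] -/
theorem cellIdentity_code (Θ : ℝ → EuclideanSpace ℝ (Fin 2) → ℝ) (p : Fin 2 → Fin 5) (z : EuclideanSpace ℝ (Fin 2)) :
    c.toSymm.actScalar Θ 0 ((5 : ℝ) • z - latticeVec (fun k => ((p k : ℕ) : ℤ))) =
      Θ 0 (c.codePoint (WithLp.toLp 2 ![5 * z 0 - (p 0 : ℕ), 5 * z 1 - (p 1 : ℕ)])) := by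
  rw [c.actScalar_eq_codePoint, smul_sub_latticeVec_eq]

end Cells

/-! ## The self-similarity hypothesis from coordinate identities -/

/-- The transversal axis of a straight child: `0` if the code swaps (vertical child), else `1`.
[folklore] -/
def transAxis (c : SymmCode) : Fin 2 := if c.swap then 0 else 1

/-- The transversal axis is `perm⁻¹ 1`. [folklore] -/
theorem perm_symm_one_eq_transAxis (c : SymmCode) : c.perm.symm 1 = transAxis c := by
  unfold transAxis
  cases hc : c.swap
  · rw [c.perm_symm_apply_of_swap_false hc]; rfl
  · rw [c.perm_symm_one_of_swap_true hc]; rfl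

/-- **Generator-level self-similarity from coordinate identities.** For arbitrary tables
`(childGen, childSym)`: if the straight generator's initial datum is the transversal profile
`G(u₁ - 1/2)` on the open unit square with `G` even, and on each open subsquare `p` of each
generator `g` the field at `t = 1` is
* `G(5 z_k - p_k - 1/2)`, `k = transAxis (childSym g p)`, when the child is straight, and
* `Θ₀ B 0 ((childSym g p).codePoint (5 z₀ - p₀, 5 z₁ - p₁))` when the child is bent,
then the hypothesis `hS` of `acm_compatible_blocks_of_generators` /
`acm_compatible_blocks_of_generator_moves` holds. [folklore] -/
theorem selfSimilar_of_cells {Θ₀ : Gen → ℝ → EuclideanSpace ℝ (Fin 2) → ℝ} {G : ℝ → ℝ}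
    (childGen : Gen → (Fin 2 → Fin 5) → Gen) (childSym : Gen → (Fin 2 → Fin 5) → SymmCode)
    (hG : ∀ x, G (-x) = G x) (hΘS : ∀ u : EuclideanSpace ℝ (Fin 2), (∀ k, u k ∈ Ioo (0 : ℝ) 1) → Θ₀ Gen.S 0 u = G (u 1 - 2⁻¹))
    (hstraight : ∀ (g : Gen) (p : Fin 2 → Fin 5), childGen g p = Gen.S →
      ∀ z ∈ latticeCellInterior 5 (fun k => ((p k : ℕ) : ℤ)),
        Θ₀ g 1 z = G (5 * z (transAxis (childSym g p)) - (p (transAxis (childSym g p)) : ℕ) - 2⁻¹))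
    (hbent : ∀ (g : Gen) (p : Fin 2 → Fin 5), childGen g p = Gen.B →
      ∀ z ∈ latticeCellInterior 5 (fun k => ((p k : ℕ) : ℤ)),
        Θ₀ g 1 z = Θ₀ Gen.B 0 ((childSym g p).codePoint (WithLp.toLp 2 ![5 * z 0 - (p 0 : ℕ), 5 * z 1 - (p 1 : ℕ)]))) :
    ∀ (g : Gen) (p : Fin 2 → Fin 5), ∀ z ∈ latticeCellInterior 5 (fun k => ((p k : ℕ) : ℤ)),
      Θ₀ g 1 z = (childSym g p).toSymm.actScalar (Θ₀ (childGen g p)) 0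
        ((5 : ℝ) • z - latticeVec (fun k => ((p k : ℕ) : ℤ))) := by
  intro g p z hz
  cases hg : childGen g p
  · rw [cellIdentity_straight (childSym g p) hG hΘS hz, perm_symm_one_eq_transAxis]
    exact hstraight g p hg z hz
  · rw [cellIdentity_code (childSym g p)]
    exact hbent g p hg z hz

end QuasiSelfSimilar

end Literature.Analysis.FluidPDE

end
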